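import Literature.MathematicalPhysics.QuantumFieldTheory.Balaban1983to89.B11Eq88LaplaceH1CurrentTwoBackgroundLetter
import Literature.MathematicalPhysics.QuantumFieldTheory.Balaban1983to89.B11Eq88LaplaceH1CurrentNorm

/-!
# `Balaban1983to89.B11Eq88LaplaceH1CurrentTwoBackgroundOneBlockColumn` — T. Bałaban, *The variational problem and background fields in renormalization group method for
# lattice gauge theories*, Commun. Math. Phys. **102** (1985) 277–309 [Balaban1985Variational] (87)–(88) p. 291, (129) p. 297, (45) p. 285, (115) p. 294, Prop. 6 (117) p. 295;
# [Balaban1985BackgroundPropagators] (3.122) p. 420, (3.126) p. 420, (3.132)–(3.133) p. 422, Thm 3.4 p. 400: **THE TWO-BACKGROUND ONE-BLOCK LETTER `δhk′` AND THE TWO-BACKGROUND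
# NORM `δN` OF THE COMPOSITE CURRENT `(Δ̃_{a,k} − Q_k†aQ_k)∘H̃_{1,k}` READ IN THE (115) CARRIERS, LATTICE-FREE** — at `U` print's operator (3.122) `laplaceAkPi` with `H̃_{1,k}(U)`, at the
# vacuum the chain's `laplaceAk` with `H_{1,k}(1)` (print's letters there ARE the chain's, `B9Eq3119DeltaPiTowerFlat`): for the block field `δ_yZ`,
# `‖(cur_U(T_U H̃_U δ_yZ))(b) − (cur_1(T_1 H_1 δ_yZ))(b)‖ ≤ (j₀ + α)(M_φKM_φ′)e^{−κ·d_m(Π(b₋), y₋)}‖Z‖` (§1, the reading `equiv_currentCLM` ∕ `H1CLM_apply` of this generation's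
# Hilbert-level `B11Eq88LaplaceH1CurrentTwoBackgroundLetter`, (129) + (45) on both sides), and by the row count `‖cur_U(T_UH̃_UX) − cur_1(T_1H_1X)‖₍₋₃₎ ≤ w̄₃(j₀ + α)(M_φKM_φ′)dK_d(κ)w̲_B⁻¹‖X‖`
# (§2) — the letters `δhk′` of `B11Eq88KernelColumnsCompositeTwoBackgrounds` and `δN` of `B11Eq98W80TwoBackgroundLetters`

statement-level skeleton of published theorems with citation tags; proofs where landed; nothing here is a claim about the Yang–Mills mass gap

CITATION HEADER (lean-in-tree rule).  Audit cell `pub-balaban`, sub-cell `t4`, BINDER row NE9; NE9 crux-team LEAF PROVER 01 (`b2b-balaban-t4-ne9-formalise-leaf-01`, gen 105; ROUTE (J′),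
the `δ_W` brick; bears_on: R4/N22).  Composed BY NAME, nothing restated: `exists_local_letter_QadjKinvSub_sub_flat` (this generation), `B9Eq3119DeltaPiCarrier.equiv_currentCLM`,
`B11Eq88LaplaceH1Identity.laplaceALatticeK_H1LatticeK`, `B11Eq103H1Complex.Q_H1LatticeK`, the row count of gen 97's `B11Eq88LaplaceH1CurrentNorm`.  Sources read through the audited
headers of those files.  NOTHING of print's proof is reproduced: [folklore] readings.

WHAT IS PROVED (sorry-free; proof lane — no `def`).  §1 **`exists_oneBlock_letter_laplaceH1_current_sub_flat`**; §2 **`exists_norm_current_laplaceH1_sub_flat_le`** — `∃ α₁ j₁ K κ`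
BEFORE the union binder block of gen 101's `exists_letter_H1kPi_sub_flat` (+ `[Fact (0 < η)]`, `hQ1`), then for every carrier data `(lev₀ lev₁ Dc₁ Dc₂ levB)` the two displays above.
HONEST SCOPE.  Composition BY NAME on the cell's MODEL rows (O-NE9-1; #5 UNRULED); constants crude; first order at the flat point; `j₀` and `α` displayed separately; the windows,
`c₀ = η^d`, unitarity, the tower data, the positivity and onto witnesses at `U` and at `1` stay HYPOTHESES; nothing of [B9] (3.122), (3.132)–(3.133) ∕ Thm 3.4 or [B11] (88), (117)
asserted as printed; «NE9 ⇐ the named binders»; NE9 NOT PRINTED ∕ NOT PROVED; spine PROVED 0∕9; rung (B)+1 finite T⁴ — NOT infinite volume, NOT mass gap, NOT BetaPertH, NOT Clay.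
HONEST DEPENDENCY: continuum YM on T⁴ ⇐ BetaPertH ∧ nine spine estimates (0/9 proved); BetaPertH ⇐ (D1) ∧ (D4) ∧ CAP+tail; G-an2-4 gates asym, D1 and NE2/3/4.  NEW file; nothing
modified.  Net new unproved facts: 0.
-/

noncomputable section

open scoped InnerProductSpace ComplexConjugate BigOperators

namespace Literature.MathematicalPhysics.QuantumFieldTheory.Balaban1983to89.B11Eq88LaplaceH1CurrentTwoBackgroundOneBlockColumn

open B4Sect5Torus (TSite tdist tdist_nonneg tdist_symm torusSum_le)
open B4Sect5Proof (latticeConst latticeConst_nonneg)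
open B9SectCLatticeCarrier (Bond bpos shift unshift shift_unshift)
open B9Eq311L2Pairing (WL2)
open B9Eq319QprimeTorus (blockCoord)
open B7Prop1Explicit (U1 Wcx boxVec)
open B11Eq103H1Complex (SiteL2K BondL2K KinvLatticeK H1LatticeK H1LatticeCLM H1CLM funEquiv funEquiv_symm_apply Q_H1LatticeK)
open B9Eq310DeltaPrime (plaqHolU)
open B9Eq310HessianOperator (adTransportW hessOp)
open B9Eq315QTorus (perCfg cornerSite)
open B9Eq315QTower (towerP UlevOf)
open B9Eq315QTowerFlat (perCfg_UlevOf_one_mem_U1 norm_Wcx_UlevOf_one_sub_one_le)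
open B9Eq316TowerFlatIsOneStep (towerP_eq_fineP_pow siteCast)
open B9Eq326OperatorTower (QkW laplaceAk G1k H1k RofUk)
open B9Eq324DeltaPrimeATower (laplacePrimeAk)
open B9Eq3119DeltaPiTower (laplaceAkPi)
open B9Eq3119DeltaPiCarrier (currentCLM equiv_currentCLM)
open B11Eq88LaplaceH1Identity (laplaceALatticeK_H1LatticeK)
open B11Eq90V0primeCurrent (flat115 flat115_apply)
open B11Eq73KernelColumnsCarrier (negSup_sum_single)
open B11Eq88LaplaceH1CurrentTwoBackgroundLetter (exists_local_letter_QadjKinvSub_sub_flat)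
open B11Eq115Space

variable {d : ℕ} (hd : 1 ≤ d) (L : ℕ) [NeZero L] (hL : 1 ≤ L) (hL3 : 3 ≤ L)
  {𝔸 : Type*} [NormedRing 𝔸] [NormedAlgebra ℂ 𝔸] [CompleteSpace 𝔸] [NormOneClass 𝔸] [StarRing 𝔸] [NormedStarGroup 𝔸] [StarModule ℂ 𝔸] [FiniteDimensional ℂ 𝔸]
  {W : Type*} [NormedAddCommGroup W] [InnerProductSpace ℂ W] [FiniteDimensional ℂ W] (φ : W ≃ₗ[ℂ] 𝔸)
  {Mφ Mφ' : ℝ} (hMφ : 0 ≤ Mφ) (hMφ' : 0 ≤ Mφ') (hφ : ∀ w, ‖φ w‖ ≤ Mφ * ‖w‖) (hφ' : ∀ X, ‖φ.symm X‖ ≤ Mφ' * ‖X‖) (hstar : ∀ X : 𝔸, ‖star X‖ ≤ ‖X‖)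
  {a : ℝ} (ha : 0 < a) {a' : ℝ} (ha' : 0 < a') {ϱ : ℝ} (hϱ0 : 0 ≤ ϱ) (hϱ1 : ϱ < 1)
  (τ : 𝔸 →ₗ[ℂ] ℂ) {Cτ : ℝ} (hτ : ∀ X, ‖τ X‖ ≤ Cτ * ‖X‖) (hCτ : 0 ≤ Cτ) {Mτ : ℝ} (hτm : ∀ X Y : 𝔸, ‖τ (X * Y)‖ ≤ Mτ * ‖X‖ * ‖Y‖) (hMτ : 0 ≤ Mτ)
  {ρw : ℝ} (hρw : 0 ≤ ρw)
  (hτ₁ : ∀ X : 𝔸, τ (star X) = conj (τ X)) (hτ₂ : ∀ X Y : 𝔸, τ (X * Y) = τ (Y * X)) (hφτ : ∀ X Y : 𝔸, ⟪φ.symm X, φ.symm Y⟫_ℂ = τ (star X * Y))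
  (AQ : ℝ)
  {ι : Type} [Fintype ι] [DecidableEq ι] (b : Module.Basis ι ℝ 𝔸) {M₂ : ℝ} (hM₂ : 0 ≤ M₂) (hrepr : ∀ (v : 𝔸) (i : ι), |b.repr v i| ≤ M₂ * ‖v‖)


/-! ## §1 The two-background one-block letter of the composite current in the (115) carriers -/

include hd hL hL3 hMφ hMφ' hφ hφ' hstar ha ha' hϱ0 hϱ1 hτ hCτ hτm hMτ hρw hτ₁ hτ₂ hφτ hM₂ hrepr in
set_option maxHeartbeats 3200000 in
set_option maxRecDepth 8192 in
/-- **THE TWO-BACKGROUND ONE-BLOCK LETTER `δhk′` OF THE COMPOSITE CURRENT IN THE (115) CARRIERS** — see the module docstring. [folklore]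
[cite: Balaban1985Variational, (87)–(88) p.291, (129) p.297, (45) p.285, (117) p.295; Balaban1985BackgroundPropagators, (3.122) p.420, (3.132)–(3.133) p.422, Thm 3.4 p.400] -/
theorem exists_oneBlock_letter_laplaceH1_current_sub_flat [Fact (0 < (L : ℝ))] :
    ∃ α₁ j₁ K κ : ℝ, 0 < α₁ ∧ 0 < j₁ ∧ 0 ≤ K ∧ 0 < κ ∧
      ∀ (n : ℕ) (η : ℝ) [Fact (0 < η)] (_hηL : η * (L : ℝ) ^ (n + 1) = 1) (c₀ c₁ : ℝ) [Fact (0 < c₀)] [Fact (0 < c₁)]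
        (_hw : c₀ * ((L : ℝ) ^ (n + 1)) ^ d = c₁) (_hρ : |η| ^ d / c₀ ≤ ρw) (m : Fin d → ℕ) [∀ i, NeZero (m i)] (_hm : ∀ i, 1 ≤ m i)
        (U : Bond d (towerP L m (n + 1)) → 𝔸ˣ) (αU : ℕ → ℝ) (_hα0 : ∀ j, 0 ≤ αU j) (hα1 : ∀ j, αU j ≤ 1 / 64)
        (hαL : ∀ j, 50 * (d + 1) * αU j * (L : ℝ) ^ d ≤ 1 / 2)
        (hU1 : ∀ (j : ℕ) (x : B7Prop1Explicit.Site d) (k : Fin d), perCfg (towerP L m (j + 1)) (UlevOf L m (n + 1) U j) x k ∈ U1 𝔸)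
        (hreg : ∀ (j : ℕ) (y : TSite d (towerP L m j)) (k : Fin d) (ρ' : Fin d → Fin L),
          ‖((Wcx L (perCfg (towerP L m (j + 1)) (UlevOf L m (n + 1) U j)) (cornerSite L y) k (boxVec L ρ') : 𝔸ˣ) : 𝔸) - 1‖ ≤ αU j)
        (εU : ℕ → ℝ) (_hεU : ∀ j, 0 ≤ εU j) (_hε1 : ∀ j, εU j ≤ 1) (_hUε : ∀ (j : ℕ) (b : Bond d (towerP L m (j + 1))), ‖(UlevOf L m (n + 1) U j b : 𝔸) - 1‖ ≤ εU j)
        (_hLb : ∀ (j : ℕ) (b : Bond d (towerP L m (j + 1))), UlevOf L m (n + 1) U j b ∈ U1 𝔸)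
        (α : ℝ) (_hα : 0 ≤ α) (_hαle : α ≤ α₁)
        (hUst : ∀ b, star (U b : 𝔸) = (((U b)⁻¹ : 𝔸ˣ) : 𝔸)) (_hUb : ∀ b, U b ∈ U1 𝔸) (_hUη : ∀ b, ‖(U b : 𝔸) - 1‖ ≤ α * η)
        (_hUw : ∀ (x : TSite d (towerP L m (n + 1))) (μ ν : Fin d), ‖(U (shift ν x, μ) : 𝔸) - (U (x, μ) : 𝔸)‖ ≤ α * η ^ 2)
        (_hpl : ∀ p : B9SectCLatticeCarrier.Plaq d (towerP L m (n + 1)), ‖(plaqHolU U p : 𝔸) - 1‖ ≤ α * η ^ 2)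
        (_hUgrad : ∀ (x : TSite d (towerP L m (n + 1))) (μ : Fin d), ‖(U (x, μ) : 𝔸) - U (unshift μ x, μ)‖ ≤ α * η ^ 2)
        (_hRlev : ∀ (j : ℕ) (b : Bond d (towerP L m (j + 1))) (w : W), ‖adTransportW φ (UlevOf L m (n + 1) U j) b w‖ ≤ ‖w‖)
        (_hεg : ∀ j < n + 1, εU j ≤ α * ϱ ^ j) (_hAQ : ∑ j ∈ Finset.range (n + 1), αU j ≤ AQ)
        (hpos' : ∀ x : SiteL2K ℂ d (towerP L m (n + 1)) c₀ W, x ≠ 0 → 0 < RCLike.re ⟪x, laplacePrimeAk L m n φ η U a' (c₁ := c₁) x⟫_ℂ)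
        (hpos : ∀ x : BondL2K ℂ d (towerP L m (n + 1)) c₀ W, x ≠ 0 →
          0 < RCLike.re ⟪x, laplaceAk L m n φ η U hL αU hα1 hU1 hreg τ (c₀ := c₀) (c₁ := c₁) a x⟫_ℂ)
        (_hc₀η : c₀ = η ^ d) (j₀ : ℝ) (_hJ : ∀ μ y, ‖B9Eq39Adjoint.J (fun μ => B9Eq33CovDerivVector.shiftEquiv μ) (fun μ y => U (y, μ)) η μ y‖ ≤ j₀) (_hj : j₀ ≤ j₁)
        (hposπ : ∀ x : BondL2K ℂ d (towerP L m (n + 1)) c₀ W, x ≠ 0 →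
          0 < RCLike.re ⟪x, laplaceAkPi L m n φ τ η U a' hpos' hL αU hα1 hU1 hreg (c₁ := c₁) a x⟫_ℂ)
        (hQ : Function.Surjective (QkW L m n φ U hL αU hα1 hU1 hreg (c₀ := c₀) (c₁ := c₁)))
        (hpos'₁ : ∀ x : SiteL2K ℂ d (towerP L m (n + 1)) c₀ W, x ≠ 0 →
          0 < RCLike.re ⟪x, laplacePrimeAk L m n φ η (fun _ : Bond d (towerP L m (n + 1)) => (1 : 𝔸ˣ)) a' (c₁ := c₁) x⟫_ℂ)
        (hpos₁ : ∀ x : BondL2K ℂ d (towerP L m (n + 1)) c₀ W, x ≠ 0 →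
          0 < RCLike.re ⟪x, laplaceAk L m n φ η (fun _ : Bond d (towerP L m (n + 1)) => (1 : 𝔸ˣ)) hL (fun _ => 0) (fun _ => by norm_num)
            (perCfg_UlevOf_one_mem_U1 L m (n + 1)) (norm_Wcx_UlevOf_one_sub_one_le L m (n + 1) (fun _ => 0) (fun _ => le_rfl)) τ
            (c₀ := c₀) (c₁ := c₁) a x⟫_ℂ)
        (hQ1 : Function.Surjective (QkW L m n φ (fun _ : Bond d (towerP L m (n + 1)) => (1 : 𝔸ˣ)) hL (fun _ => 0) (fun _ => by norm_num)
          (perCfg_UlevOf_one_mem_U1 L m (n + 1)) (norm_Wcx_UlevOf_one_sub_one_le L m (n + 1) (fun _ => 0) (fun _ => le_rfl)) (c₀ := c₀) (c₁ := c₁)))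
        (lev₀ : Bond d (towerP L m (n + 1)) → ℕ) {κ' : Type*} [Fintype κ'] (lev₁ : κ' → ℕ)
        (Dc₁ Dc₂ : (Bond d (towerP L m (n + 1)) → 𝔸) →ₗ[ℂ] (κ' → 𝔸)) (levB : Bond d m → ℕ)
        (y : Bond d m) (Z : 𝔸) (bd : Bond d (towerP L m (n + 1))),
        ‖NegSup.equiv (levWeight (L : ℝ) η lev₀ 3) 𝔸
            (currentCLM φ lev₁ Dc₁ (laplaceAkPi L m n φ τ η U a' hpos' hL αU hα1 hU1 hreg (c₁ := c₁) a
                - LinearMap.adjoint (QkW L m n φ U hL αU hα1 hU1 hreg (c₀ := c₀) (c₁ := c₁)) ∘ₗ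
                    ((a : ℂ) • QkW L m n φ U hL αU hα1 hU1 hreg (c₀ := c₀) (c₁ := c₁)))
              ((H1LatticeCLM (L := (L : ℝ)) (η := η) (lev₀ := lev₀) (levB := levB) φ hposπ hQ lev₁ Dc₁ ((NegSup.equiv (levWeight (L : ℝ) η levB 0) 𝔸).symm (Pi.single y Z))))) bd -
          NegSup.equiv (levWeight (L : ℝ) η lev₀ 3) 𝔸
            (currentCLM φ lev₁ Dc₂ (laplaceAk L m n φ η (fun _ : Bond d (towerP L m (n + 1)) => (1 : 𝔸ˣ)) hL (fun _ => 0) (fun _ => by norm_num)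
                  (perCfg_UlevOf_one_mem_U1 L m (n + 1)) (norm_Wcx_UlevOf_one_sub_one_le L m (n + 1) (fun _ => 0) (fun _ => le_rfl)) τ (c₀ := c₀) (c₁ := c₁) a
                - LinearMap.adjoint (QkW L m n φ (fun _ : Bond d (towerP L m (n + 1)) => (1 : 𝔸ˣ)) hL (fun _ => 0) (fun _ => by norm_num)
              (perCfg_UlevOf_one_mem_U1 L m (n + 1)) (norm_Wcx_UlevOf_one_sub_one_le L m (n + 1) (fun _ => 0) (fun _ => le_rfl)) (c₀ := c₀) (c₁ := c₁)) ∘ₗ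
                    ((a : ℂ) • (QkW L m n φ (fun _ : Bond d (towerP L m (n + 1)) => (1 : 𝔸ˣ)) hL (fun _ => 0) (fun _ => by norm_num)
              (perCfg_UlevOf_one_mem_U1 L m (n + 1)) (norm_Wcx_UlevOf_one_sub_one_le L m (n + 1) (fun _ => 0) (fun _ => le_rfl)) (c₀ := c₀) (c₁ := c₁))))
              ((H1LatticeCLM (L := (L : ℝ)) (η := η) (lev₀ := lev₀) (levB := levB) (c := ((η : ℂ))⁻¹)
              (R := adTransportW φ (fun _ : Bond d (towerP L m (n + 1)) => (1 : 𝔸ˣ)))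
              (S := adTransportW φ fun _ : Bond d (towerP L m (n + 1)) => (1 : 𝔸ˣ)⁻¹) (Δ₁ := hessOp φ η (fun _ : Bond d (towerP L m (n + 1)) => (1 : 𝔸ˣ)) τ)
              (Rr := RofUk L m n φ η (fun _ : Bond d (towerP L m (n + 1)) => (1 : 𝔸ˣ)))
              (Q := (QkW L m n φ (fun _ : Bond d (towerP L m (n + 1)) => (1 : 𝔸ˣ)) hL (fun _ => 0) (fun _ => by norm_num)
                (perCfg_UlevOf_one_mem_U1 L m (n + 1)) (norm_Wcx_UlevOf_one_sub_one_le L m (n + 1) (fun _ => 0) (fun _ => le_rfl)) (c₀ := c₀) (c₁ := c₁))) (a := a)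
              φ hpos₁ hQ1 lev₁ Dc₂ ((NegSup.equiv (levWeight (L : ℝ) η levB 0) 𝔸).symm (Pi.single y Z))))) bd‖ ≤
          (j₀ + α) * (Mφ * K * Mφ') * Real.exp (-(κ * tdist m (blockCoord (L ^ (n + 1)) m (siteCast (towerP_eq_fineP_pow L m (n + 1)) (bpos bd))) (bpos y))) * ‖Z‖ := by
  classical
  obtain ⟨α₁, j₁, K, κ, hα₁, hj₁, hK, hκ, HK⟩ :=
    exists_local_letter_QadjKinvSub_sub_flat hd L hL hL3 φ hMφ hMφ' hφ hφ' hstar ha ha' hϱ0 hϱ1 τ hτ hCτ hτm hMτ hρw hτ₁ hτ₂ hφτ AQ b hM₂ hrepr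
  refine ⟨α₁, j₁, K, κ, hα₁, hj₁, hK, hκ, ?_⟩
  intro n η _ hηL c₀ c₁ _ _ hw hρ m _ hm U αU hα0 hα1 hαL hU1 hreg εU hεU hε1 hUε hLb α hα hαle hUst hUb hUη hUw hpl hUgrad hRlev hεg hAQ hpos' hpos hc₀η j₀ hJ hj
    hposπ hQ hpos'₁ hpos₁ hQ1 lev₀ κ' _ lev₁ Dc₁ Dc₂ levB y Z bd
  -- the one-block field read in the Hilbert fibre: supported at `y₋`, values bounded by `M_φ′‖Z‖`
  have hzv : ∀ c', bpos c' ≠ bpos y → WL2.equiv ℂ (fun _ : Bond d m => c₁) W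
      ((funEquiv φ (fun _ : Bond d m => c₁)).symm (Pi.single y Z)) c' = 0 := by
    intro c' hc'
    have hne : c' ≠ y := fun h => hc' (by rw [h])
    rw [funEquiv_symm_apply, Pi.single_eq_of_ne hne, map_zero]
  have hzF : ∀ c', ‖WL2.equiv ℂ (fun _ : Bond d m => c₁) W ((funEquiv φ (fun _ : Bond d m => c₁)).symm (Pi.single y Z)) c'‖ ≤ Mφ' * ‖Z‖ := by
    intro c'
    rw [funEquiv_symm_apply]
    refine (hφ' _).trans (mul_le_mul_of_nonneg_left ?_ hMφ')
    by_cases h : c' = y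
    · rw [h, Pi.single_eq_same]
    · rw [Pi.single_eq_of_ne h, norm_zero]; exact norm_nonneg _
  have h := HK n η hηL c₀ c₁ hw hρ m hm U αU hα0 hα1 hαL hU1 hreg εU hεU hε1 hUε hLb α hα hαle hUst hUb hUη hUw hpl hUgrad hRlev hεg hAQ hpos' hpos hc₀η j₀ hJ hj
    hposπ hQ hpos'₁ hpos₁ hQ1 (bpos y) ((funEquiv φ (fun _ : Bond d m => c₁)).symm (Pi.single y Z)) (Mφ' * ‖Z‖) hzv hzF bd
  -- the readings: `current(T)(H B)` at `bd` is `φ` of `T(H z)` at `bd`, and `T(H z) = Q†K⁻¹z − a·Q†z` by (129) + (45), on both sides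
  have e₁ : flat115 ((H1LatticeCLM (L := (L : ℝ)) (η := η) (lev₀ := lev₀) (levB := levB) φ hposπ hQ lev₁ Dc₁ ((NegSup.equiv (levWeight (L : ℝ) η levB 0) 𝔸).symm (Pi.single y Z))))
      = funEquiv φ (fun _ : Bond d (towerP L m (n + 1)) => c₀) (H1LatticeK hposπ hQ
          ((funEquiv φ (fun _ : Bond d m => c₁)).symm (NegSup.equiv (levWeight (L : ℝ) η levB 0) 𝔸 ((NegSup.equiv (levWeight (L : ℝ) η levB 0) 𝔸).symm (Pi.single y Z))))) := rfl
  have e₂ : flat115 ((H1LatticeCLM (L := (L : ℝ)) (η := η) (lev₀ := lev₀) (levB := levB) (c := ((η : ℂ))⁻¹)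
              (R := adTransportW φ (fun _ : Bond d (towerP L m (n + 1)) => (1 : 𝔸ˣ)))
              (S := adTransportW φ fun _ : Bond d (towerP L m (n + 1)) => (1 : 𝔸ˣ)⁻¹) (Δ₁ := hessOp φ η (fun _ : Bond d (towerP L m (n + 1)) => (1 : 𝔸ˣ)) τ)
              (Rr := RofUk L m n φ η (fun _ : Bond d (towerP L m (n + 1)) => (1 : 𝔸ˣ)))
              (Q := (QkW L m n φ (fun _ : Bond d (towerP L m (n + 1)) => (1 : 𝔸ˣ)) hL (fun _ => 0) (fun _ => by norm_num)
                (perCfg_UlevOf_one_mem_U1 L m (n + 1)) (norm_Wcx_UlevOf_one_sub_one_le L m (n + 1) (fun _ => 0) (fun _ => le_rfl)) (c₀ := c₀) (c₁ := c₁))) (a := a)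
              φ hpos₁ hQ1 lev₁ Dc₂ ((NegSup.equiv (levWeight (L : ℝ) η levB 0) 𝔸).symm (Pi.single y Z))))
      = funEquiv φ (fun _ : Bond d (towerP L m (n + 1)) => c₀) (H1LatticeK (c := ((η : ℂ))⁻¹) (R := adTransportW φ (fun _ : Bond d (towerP L m (n + 1)) => (1 : 𝔸ˣ)))
          (S := adTransportW φ fun _ : Bond d (towerP L m (n + 1)) => (1 : 𝔸ˣ)⁻¹) (Δ₁ := hessOp φ η (fun _ : Bond d (towerP L m (n + 1)) => (1 : 𝔸ˣ)) τ)
          (Rr := RofUk L m n φ η (fun _ : Bond d (towerP L m (n + 1)) => (1 : 𝔸ˣ)))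
          (Q := (QkW L m n φ (fun _ : Bond d (towerP L m (n + 1)) => (1 : 𝔸ˣ)) hL (fun _ => 0) (fun _ => by norm_num)
            (perCfg_UlevOf_one_mem_U1 L m (n + 1)) (norm_Wcx_UlevOf_one_sub_one_le L m (n + 1) (fun _ => 0) (fun _ => le_rfl)) (c₀ := c₀) (c₁ := c₁))) (a := a)
          hpos₁ hQ1
          ((funEquiv φ (fun _ : Bond d m => c₁)).symm (NegSup.equiv (levWeight (L : ℝ) η levB 0) 𝔸 ((NegSup.equiv (levWeight (L : ℝ) η levB 0) 𝔸).symm (Pi.single y Z))))) := rfl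
  have r₁ : NegSup.equiv (levWeight (L : ℝ) η lev₀ 3) 𝔸
      (currentCLM φ lev₁ Dc₁ (laplaceAkPi L m n φ τ η U a' hpos' hL αU hα1 hU1 hreg (c₁ := c₁) a
                - LinearMap.adjoint (QkW L m n φ U hL αU hα1 hU1 hreg (c₀ := c₀) (c₁ := c₁)) ∘ₗ
                    ((a : ℂ) • QkW L m n φ U hL αU hα1 hU1 hreg (c₀ := c₀) (c₁ := c₁)))
        ((H1LatticeCLM (L := (L : ℝ)) (η := η) (lev₀ := lev₀) (levB := levB) φ hposπ hQ lev₁ Dc₁ ((NegSup.equiv (levWeight (L : ℝ) η levB 0) 𝔸).symm (Pi.single y Z))))) bd =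
      φ (WL2.equiv ℂ (fun _ : Bond d (towerP L m (n + 1)) => c₀) W
        (LinearMap.adjoint (QkW L m n φ U hL αU hα1 hU1 hreg (c₀ := c₀) (c₁ := c₁)) (KinvLatticeK hposπ hQ ((funEquiv φ (fun _ : Bond d m => c₁)).symm (Pi.single y Z)))
          - (a : ℂ) • LinearMap.adjoint (QkW L m n φ U hL αU hα1 hU1 hreg (c₀ := c₀) (c₁ := c₁)) ((funEquiv φ (fun _ : Bond d m => c₁)).symm (Pi.single y Z))) bd) := by
    rw [equiv_currentCLM, e₁, LinearEquiv.symm_apply_apply, Equiv.apply_symm_apply, LinearMap.sub_apply, LinearMap.comp_apply, LinearMap.smul_apply, map_smul]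
    erw [laplaceALatticeK_H1LatticeK hposπ hQ, Q_H1LatticeK hposπ hQ]
  have r₂ : NegSup.equiv (levWeight (L : ℝ) η lev₀ 3) 𝔸
      (currentCLM φ lev₁ Dc₂ (laplaceAk L m n φ η (fun _ : Bond d (towerP L m (n + 1)) => (1 : 𝔸ˣ)) hL (fun _ => 0) (fun _ => by norm_num)
                  (perCfg_UlevOf_one_mem_U1 L m (n + 1)) (norm_Wcx_UlevOf_one_sub_one_le L m (n + 1) (fun _ => 0) (fun _ => le_rfl)) τ (c₀ := c₀) (c₁ := c₁) a
                - LinearMap.adjoint (QkW L m n φ (fun _ : Bond d (towerP L m (n + 1)) => (1 : 𝔸ˣ)) hL (fun _ => 0) (fun _ => by norm_num)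
              (perCfg_UlevOf_one_mem_U1 L m (n + 1)) (norm_Wcx_UlevOf_one_sub_one_le L m (n + 1) (fun _ => 0) (fun _ => le_rfl)) (c₀ := c₀) (c₁ := c₁)) ∘ₗ
                    ((a : ℂ) • (QkW L m n φ (fun _ : Bond d (towerP L m (n + 1)) => (1 : 𝔸ˣ)) hL (fun _ => 0) (fun _ => by norm_num)
              (perCfg_UlevOf_one_mem_U1 L m (n + 1)) (norm_Wcx_UlevOf_one_sub_one_le L m (n + 1) (fun _ => 0) (fun _ => le_rfl)) (c₀ := c₀) (c₁ := c₁))))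
        ((H1LatticeCLM (L := (L : ℝ)) (η := η) (lev₀ := lev₀) (levB := levB) (c := ((η : ℂ))⁻¹)
              (R := adTransportW φ (fun _ : Bond d (towerP L m (n + 1)) => (1 : 𝔸ˣ)))
              (S := adTransportW φ fun _ : Bond d (towerP L m (n + 1)) => (1 : 𝔸ˣ)⁻¹) (Δ₁ := hessOp φ η (fun _ : Bond d (towerP L m (n + 1)) => (1 : 𝔸ˣ)) τ)
              (Rr := RofUk L m n φ η (fun _ : Bond d (towerP L m (n + 1)) => (1 : 𝔸ˣ)))
              (Q := (QkW L m n φ (fun _ : Bond d (towerP L m (n + 1)) => (1 : 𝔸ˣ)) hL (fun _ => 0) (fun _ => by norm_num)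
                (perCfg_UlevOf_one_mem_U1 L m (n + 1)) (norm_Wcx_UlevOf_one_sub_one_le L m (n + 1) (fun _ => 0) (fun _ => le_rfl)) (c₀ := c₀) (c₁ := c₁))) (a := a)
              φ hpos₁ hQ1 lev₁ Dc₂ ((NegSup.equiv (levWeight (L : ℝ) η levB 0) 𝔸).symm (Pi.single y Z))))) bd =
      φ (WL2.equiv ℂ (fun _ : Bond d (towerP L m (n + 1)) => c₀) W
        (LinearMap.adjoint (QkW L m n φ (fun _ : Bond d (towerP L m (n + 1)) => (1 : 𝔸ˣ)) hL (fun _ => 0) (fun _ => by norm_num)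
              (perCfg_UlevOf_one_mem_U1 L m (n + 1)) (norm_Wcx_UlevOf_one_sub_one_le L m (n + 1) (fun _ => 0) (fun _ => le_rfl)) (c₀ := c₀) (c₁ := c₁))
            (KinvLatticeK (c := ((η : ℂ))⁻¹) (R := adTransportW φ (fun _ : Bond d (towerP L m (n + 1)) => (1 : 𝔸ˣ)))
                (S := adTransportW φ fun _ : Bond d (towerP L m (n + 1)) => (1 : 𝔸ˣ)⁻¹) (Δ₁ := hessOp φ η (fun _ : Bond d (towerP L m (n + 1)) => (1 : 𝔸ˣ)) τ)
                (Rr := RofUk L m n φ η (fun _ : Bond d (towerP L m (n + 1)) => (1 : 𝔸ˣ)))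
                (Q := (QkW L m n φ (fun _ : Bond d (towerP L m (n + 1)) => (1 : 𝔸ˣ)) hL (fun _ => 0) (fun _ => by norm_num)
                  (perCfg_UlevOf_one_mem_U1 L m (n + 1)) (norm_Wcx_UlevOf_one_sub_one_le L m (n + 1) (fun _ => 0) (fun _ => le_rfl)) (c₀ := c₀) (c₁ := c₁))) (a := a)
                hpos₁ hQ1 ((funEquiv φ (fun _ : Bond d m => c₁)).symm (Pi.single y Z)))
          - (a : ℂ) • LinearMap.adjoint (QkW L m n φ (fun _ : Bond d (towerP L m (n + 1)) => (1 : 𝔸ˣ)) hL (fun _ => 0) (fun _ => by norm_num)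
              (perCfg_UlevOf_one_mem_U1 L m (n + 1)) (norm_Wcx_UlevOf_one_sub_one_le L m (n + 1) (fun _ => 0) (fun _ => le_rfl)) (c₀ := c₀) (c₁ := c₁)) ((funEquiv φ (fun _ : Bond d m => c₁)).symm (Pi.single y Z))) bd) := by
    rw [equiv_currentCLM, e₂, LinearEquiv.symm_apply_apply, Equiv.apply_symm_apply, LinearMap.sub_apply, LinearMap.comp_apply, LinearMap.smul_apply, map_smul]
    erw [laplaceALatticeK_H1LatticeK hpos₁ hQ1, Q_H1LatticeK hpos₁ hQ1]
  rw [r₁, r₂, ← map_sub, ← Pi.sub_apply, ← WL2.equiv_sub]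
  refine (hφ _).trans ?_
  calc _ ≤ Mφ * ((j₀ + α) * K * Real.exp (-(κ * tdist m (blockCoord (L ^ (n + 1)) m (siteCast (towerP_eq_fineP_pow L m (n + 1)) (bpos bd))) (bpos y))) * (Mφ' * ‖Z‖)) :=
        mul_le_mul_of_nonneg_left h hMφ
    _ = _ := by ring

/-! ## §2 The two-background norm `δN` by the row count -/

include hd hL hL3 hMφ hMφ' hφ hφ' hstar ha ha' hϱ0 hϱ1 hτ hCτ hτm hMτ hρw hτ₁ hτ₂ hφτ hM₂ hrepr in
set_option maxHeartbeats 3200000 in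
set_option maxRecDepth 8192 in
/-- **THE TWO-BACKGROUND NORM `δN` OF THE COMPOSITE CURRENT** — `‖cur_U(T_UH̃_UX) − cur_1(T_1H_1X)‖₍₋₃₎ ≤ w̄₃·(j₀ + α)(M_φKM_φ′)·dK_d(κ)·w̲_B⁻¹·‖X‖`: §1 summed over the one-block pieces of
`X` (the row count of gen 97's `B11Eq88LaplaceH1CurrentNorm`). [folklore]
[cite: Balaban1985Variational, (87)–(88) p.291, (115) p.294, (117) p.295; Balaban1985BackgroundPropagators, (3.132)–(3.133) p.422, Thm 3.4 p.400] -/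
theorem exists_norm_current_laplaceH1_sub_flat_le [Fact (0 < (L : ℝ))] :
    ∃ α₁ j₁ K κ : ℝ, 0 < α₁ ∧ 0 < j₁ ∧ 0 ≤ K ∧ 0 < κ ∧
      ∀ (n : ℕ) (η : ℝ) [Fact (0 < η)] (_hηL : η * (L : ℝ) ^ (n + 1) = 1) (c₀ c₁ : ℝ) [Fact (0 < c₀)] [Fact (0 < c₁)]
        (_hw : c₀ * ((L : ℝ) ^ (n + 1)) ^ d = c₁) (_hρ : |η| ^ d / c₀ ≤ ρw) (m : Fin d → ℕ) [∀ i, NeZero (m i)] (_hm : ∀ i, 1 ≤ m i)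
        (U : Bond d (towerP L m (n + 1)) → 𝔸ˣ) (αU : ℕ → ℝ) (_hα0 : ∀ j, 0 ≤ αU j) (hα1 : ∀ j, αU j ≤ 1 / 64)
        (hαL : ∀ j, 50 * (d + 1) * αU j * (L : ℝ) ^ d ≤ 1 / 2)
        (hU1 : ∀ (j : ℕ) (x : B7Prop1Explicit.Site d) (k : Fin d), perCfg (towerP L m (j + 1)) (UlevOf L m (n + 1) U j) x k ∈ U1 𝔸)
        (hreg : ∀ (j : ℕ) (y : TSite d (towerP L m j)) (k : Fin d) (ρ' : Fin d → Fin L),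
          ‖((Wcx L (perCfg (towerP L m (j + 1)) (UlevOf L m (n + 1) U j)) (cornerSite L y) k (boxVec L ρ') : 𝔸ˣ) : 𝔸) - 1‖ ≤ αU j)
        (εU : ℕ → ℝ) (_hεU : ∀ j, 0 ≤ εU j) (_hε1 : ∀ j, εU j ≤ 1) (_hUε : ∀ (j : ℕ) (b : Bond d (towerP L m (j + 1))), ‖(UlevOf L m (n + 1) U j b : 𝔸) - 1‖ ≤ εU j)
        (_hLb : ∀ (j : ℕ) (b : Bond d (towerP L m (j + 1))), UlevOf L m (n + 1) U j b ∈ U1 𝔸)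
        (α : ℝ) (_hα : 0 ≤ α) (_hαle : α ≤ α₁)
        (hUst : ∀ b, star (U b : 𝔸) = (((U b)⁻¹ : 𝔸ˣ) : 𝔸)) (_hUb : ∀ b, U b ∈ U1 𝔸) (_hUη : ∀ b, ‖(U b : 𝔸) - 1‖ ≤ α * η)
        (_hUw : ∀ (x : TSite d (towerP L m (n + 1))) (μ ν : Fin d), ‖(U (shift ν x, μ) : 𝔸) - (U (x, μ) : 𝔸)‖ ≤ α * η ^ 2)
        (_hpl : ∀ p : B9SectCLatticeCarrier.Plaq d (towerP L m (n + 1)), ‖(plaqHolU U p : 𝔸) - 1‖ ≤ α * η ^ 2)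
        (_hUgrad : ∀ (x : TSite d (towerP L m (n + 1))) (μ : Fin d), ‖(U (x, μ) : 𝔸) - U (unshift μ x, μ)‖ ≤ α * η ^ 2)
        (_hRlev : ∀ (j : ℕ) (b : Bond d (towerP L m (j + 1))) (w : W), ‖adTransportW φ (UlevOf L m (n + 1) U j) b w‖ ≤ ‖w‖)
        (_hεg : ∀ j < n + 1, εU j ≤ α * ϱ ^ j) (_hAQ : ∑ j ∈ Finset.range (n + 1), αU j ≤ AQ)
        (hpos' : ∀ x : SiteL2K ℂ d (towerP L m (n + 1)) c₀ W, x ≠ 0 → 0 < RCLike.re ⟪x, laplacePrimeAk L m n φ η U a' (c₁ := c₁) x⟫_ℂ)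
        (hpos : ∀ x : BondL2K ℂ d (towerP L m (n + 1)) c₀ W, x ≠ 0 →
          0 < RCLike.re ⟪x, laplaceAk L m n φ η U hL αU hα1 hU1 hreg τ (c₀ := c₀) (c₁ := c₁) a x⟫_ℂ)
        (_hc₀η : c₀ = η ^ d) (j₀ : ℝ) (_hJ : ∀ μ y, ‖B9Eq39Adjoint.J (fun μ => B9Eq33CovDerivVector.shiftEquiv μ) (fun μ y => U (y, μ)) η μ y‖ ≤ j₀) (_hj : j₀ ≤ j₁)
        (hposπ : ∀ x : BondL2K ℂ d (towerP L m (n + 1)) c₀ W, x ≠ 0 →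
          0 < RCLike.re ⟪x, laplaceAkPi L m n φ τ η U a' hpos' hL αU hα1 hU1 hreg (c₁ := c₁) a x⟫_ℂ)
        (hQ : Function.Surjective (QkW L m n φ U hL αU hα1 hU1 hreg (c₀ := c₀) (c₁ := c₁)))
        (hpos'₁ : ∀ x : SiteL2K ℂ d (towerP L m (n + 1)) c₀ W, x ≠ 0 →
          0 < RCLike.re ⟪x, laplacePrimeAk L m n φ η (fun _ : Bond d (towerP L m (n + 1)) => (1 : 𝔸ˣ)) a' (c₁ := c₁) x⟫_ℂ)
        (hpos₁ : ∀ x : BondL2K ℂ d (towerP L m (n + 1)) c₀ W, x ≠ 0 →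
          0 < RCLike.re ⟪x, laplaceAk L m n φ η (fun _ : Bond d (towerP L m (n + 1)) => (1 : 𝔸ˣ)) hL (fun _ => 0) (fun _ => by norm_num)
            (perCfg_UlevOf_one_mem_U1 L m (n + 1)) (norm_Wcx_UlevOf_one_sub_one_le L m (n + 1) (fun _ => 0) (fun _ => le_rfl)) τ
            (c₀ := c₀) (c₁ := c₁) a x⟫_ℂ)
        (hQ1 : Function.Surjective (QkW L m n φ (fun _ : Bond d (towerP L m (n + 1)) => (1 : 𝔸ˣ)) hL (fun _ => 0) (fun _ => by norm_num)
          (perCfg_UlevOf_one_mem_U1 L m (n + 1)) (norm_Wcx_UlevOf_one_sub_one_le L m (n + 1) (fun _ => 0) (fun _ => le_rfl)) (c₀ := c₀) (c₁ := c₁)))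
        (lev₀ : Bond d (towerP L m (n + 1)) → ℕ) {κ' : Type*} [Fintype κ'] (lev₁ : κ' → ℕ)
        (Dc₁ Dc₂ : (Bond d (towerP L m (n + 1)) → 𝔸) →ₗ[ℂ] (κ' → 𝔸)) (levB : Bond d m → ℕ) (X : NegSize (L : ℝ) η levB 0 𝔸),
        ‖currentCLM φ lev₁ Dc₁ (laplaceAkPi L m n φ τ η U a' hpos' hL αU hα1 hU1 hreg (c₁ := c₁) a
                - LinearMap.adjoint (QkW L m n φ U hL αU hα1 hU1 hreg (c₀ := c₀) (c₁ := c₁)) ∘ₗ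
                    ((a : ℂ) • QkW L m n φ U hL αU hα1 hU1 hreg (c₀ := c₀) (c₁ := c₁)))
              ((H1LatticeCLM (L := (L : ℝ)) (η := η) (lev₀ := lev₀) (levB := levB) φ hposπ hQ lev₁ Dc₁ X)) -
          currentCLM φ lev₁ Dc₂ (laplaceAk L m n φ η (fun _ : Bond d (towerP L m (n + 1)) => (1 : 𝔸ˣ)) hL (fun _ => 0) (fun _ => by norm_num)
                  (perCfg_UlevOf_one_mem_U1 L m (n + 1)) (norm_Wcx_UlevOf_one_sub_one_le L m (n + 1) (fun _ => 0) (fun _ => le_rfl)) τ (c₀ := c₀) (c₁ := c₁) a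
                - LinearMap.adjoint (QkW L m n φ (fun _ : Bond d (towerP L m (n + 1)) => (1 : 𝔸ˣ)) hL (fun _ => 0) (fun _ => by norm_num)
              (perCfg_UlevOf_one_mem_U1 L m (n + 1)) (norm_Wcx_UlevOf_one_sub_one_le L m (n + 1) (fun _ => 0) (fun _ => le_rfl)) (c₀ := c₀) (c₁ := c₁)) ∘ₗ
                    ((a : ℂ) • (QkW L m n φ (fun _ : Bond d (towerP L m (n + 1)) => (1 : 𝔸ˣ)) hL (fun _ => 0) (fun _ => by norm_num)
              (perCfg_UlevOf_one_mem_U1 L m (n + 1)) (norm_Wcx_UlevOf_one_sub_one_le L m (n + 1) (fun _ => 0) (fun _ => le_rfl)) (c₀ := c₀) (c₁ := c₁))))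
              ((H1LatticeCLM (L := (L : ℝ)) (η := η) (lev₀ := lev₀) (levB := levB) (c := ((η : ℂ))⁻¹)
              (R := adTransportW φ (fun _ : Bond d (towerP L m (n + 1)) => (1 : 𝔸ˣ)))
              (S := adTransportW φ fun _ : Bond d (towerP L m (n + 1)) => (1 : 𝔸ˣ)⁻¹) (Δ₁ := hessOp φ η (fun _ : Bond d (towerP L m (n + 1)) => (1 : 𝔸ˣ)) τ)
              (Rr := RofUk L m n φ η (fun _ : Bond d (towerP L m (n + 1)) => (1 : 𝔸ˣ)))
              (Q := (QkW L m n φ (fun _ : Bond d (towerP L m (n + 1)) => (1 : 𝔸ˣ)) hL (fun _ => 0) (fun _ => by norm_num)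
                (perCfg_UlevOf_one_mem_U1 L m (n + 1)) (norm_Wcx_UlevOf_one_sub_one_le L m (n + 1) (fun _ => 0) (fun _ => le_rfl)) (c₀ := c₀) (c₁ := c₁))) (a := a)
              φ hpos₁ hQ1 lev₁ Dc₂ X))‖ ≤
          (NegSup.wSup (levWeight (L : ℝ) η lev₀ 3) : ℝ) * ((j₀ + α) * (Mφ * K * Mφ') * (d * latticeConst d κ)) *
            (NegSup.wInvSup (levWeight (L : ℝ) η levB 0) : ℝ) * ‖X‖ := by
  obtain ⟨α₁, j₁, K, κ, hα₁, hj₁, hK, hκ, HB⟩ :=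
    exists_oneBlock_letter_laplaceH1_current_sub_flat hd L hL hL3 φ hMφ hMφ' hφ hφ' hstar ha ha' hϱ0 hϱ1 τ hτ hCτ hτm hMτ hρw hτ₁ hτ₂ hφτ AQ b hM₂ hrepr
  refine ⟨α₁, j₁, K, κ, hα₁, hj₁, hK, hκ, ?_⟩
  intro n η _ hηL c₀ c₁ _ _ hw hρ m _ hm U αU hα0 hα1 hαL hU1 hreg εU hεU hε1 hUε hLb α hα hαle hUst hUb hUη hUw hpl hUgrad hRlev hεg hAQ hpos' hpos hc₀η j₀ hJ hj
    hposπ hQ hpos'₁ hpos₁ hQ1 lev₀ κ' _ lev₁ Dc₁ Dc₂ levB X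
  classical
  have hK0 : 0 ≤ latticeConst d κ := latticeConst_nonneg d hκ.le
  have hΩ0 : 0 ≤ (NegSup.wInvSup (levWeight (L : ℝ) η levB 0) : ℝ) := NNReal.coe_nonneg _
  have hj₀ : 0 ≤ j₀ := (norm_nonneg _).trans (hJ ⟨0, hd⟩ fun _ => 0)
  have hX : ∀ y, ‖NegSup.equiv (levWeight (L : ℝ) η levB 0) 𝔸 X y‖ ≤ (NegSup.wInvSup (levWeight (L : ℝ) η levB 0) : ℝ) * ‖X‖ := fun y =>
    (norm_le_pi_norm _ y).trans (NegSup.sup_norm_le_wInvSup_mul X)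
  have hrow : ∀ b' : Bond d (towerP L m (n + 1)),
      ∑ y : Bond d m, Real.exp (-(κ * tdist m (blockCoord (L ^ (n + 1)) m (siteCast (towerP_eq_fineP_pow L m (n + 1)) (bpos b'))) (bpos y))) ≤ d * latticeConst d κ := by
    intro b'
    rw [Fintype.sum_prod_type]
    simp only [bpos]
    rw [Finset.sum_comm, Finset.sum_const, Finset.card_univ, Fintype.card_fin, nsmul_eq_mul]
    exact mul_le_mul_of_nonneg_left (torusSum_le d hm hκ _) (Nat.cast_nonneg d)
  -- the difference as ONE continuous linear map of `X`, decomposed over the one-block pieces of `X`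
  obtain ⟨Φ, hΦ⟩ : ∃ Φ : NegSize (L : ℝ) η levB 0 𝔸 →L[ℂ] NegSize (L : ℝ) η lev₀ 3 𝔸,
      Φ = (currentCLM φ lev₁ Dc₁ (laplaceAkPi L m n φ τ η U a' hpos' hL αU hα1 hU1 hreg (c₁ := c₁) a
                - LinearMap.adjoint (QkW L m n φ U hL αU hα1 hU1 hreg (c₀ := c₀) (c₁ := c₁)) ∘ₗ
                    ((a : ℂ) • QkW L m n φ U hL αU hα1 hU1 hreg (c₀ := c₀) (c₁ := c₁)))).comp
              (H1LatticeCLM (L := (L : ℝ)) (η := η) (lev₀ := lev₀) (levB := levB) φ hposπ hQ lev₁ Dc₁) -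
          (currentCLM φ lev₁ Dc₂ (laplaceAk L m n φ η (fun _ : Bond d (towerP L m (n + 1)) => (1 : 𝔸ˣ)) hL (fun _ => 0) (fun _ => by norm_num)
                  (perCfg_UlevOf_one_mem_U1 L m (n + 1)) (norm_Wcx_UlevOf_one_sub_one_le L m (n + 1) (fun _ => 0) (fun _ => le_rfl)) τ (c₀ := c₀) (c₁ := c₁) a
                - LinearMap.adjoint (QkW L m n φ (fun _ : Bond d (towerP L m (n + 1)) => (1 : 𝔸ˣ)) hL (fun _ => 0) (fun _ => by norm_num)
              (perCfg_UlevOf_one_mem_U1 L m (n + 1)) (norm_Wcx_UlevOf_one_sub_one_le L m (n + 1) (fun _ => 0) (fun _ => le_rfl)) (c₀ := c₀) (c₁ := c₁)) ∘ₗ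
                    ((a : ℂ) • (QkW L m n φ (fun _ : Bond d (towerP L m (n + 1)) => (1 : 𝔸ˣ)) hL (fun _ => 0) (fun _ => by norm_num)
              (perCfg_UlevOf_one_mem_U1 L m (n + 1)) (norm_Wcx_UlevOf_one_sub_one_le L m (n + 1) (fun _ => 0) (fun _ => le_rfl)) (c₀ := c₀) (c₁ := c₁))))).comp
              (H1LatticeCLM (L := (L : ℝ)) (η := η) (lev₀ := lev₀) (levB := levB) (c := ((η : ℂ))⁻¹)
              (R := adTransportW φ (fun _ : Bond d (towerP L m (n + 1)) => (1 : 𝔸ˣ)))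
              (S := adTransportW φ fun _ : Bond d (towerP L m (n + 1)) => (1 : 𝔸ˣ)⁻¹) (Δ₁ := hessOp φ η (fun _ : Bond d (towerP L m (n + 1)) => (1 : 𝔸ˣ)) τ)
              (Rr := RofUk L m n φ η (fun _ : Bond d (towerP L m (n + 1)) => (1 : 𝔸ˣ)))
              (Q := (QkW L m n φ (fun _ : Bond d (towerP L m (n + 1)) => (1 : 𝔸ˣ)) hL (fun _ => 0) (fun _ => by norm_num)
                (perCfg_UlevOf_one_mem_U1 L m (n + 1)) (norm_Wcx_UlevOf_one_sub_one_le L m (n + 1) (fun _ => 0) (fun _ => le_rfl)) (c₀ := c₀) (c₁ := c₁))) (a := a)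
              φ hpos₁ hQ1 lev₁ Dc₂) := ⟨_, rfl⟩
  have hΦX : currentCLM φ lev₁ Dc₁ (laplaceAkPi L m n φ τ η U a' hpos' hL αU hα1 hU1 hreg (c₁ := c₁) a
                - LinearMap.adjoint (QkW L m n φ U hL αU hα1 hU1 hreg (c₀ := c₀) (c₁ := c₁)) ∘ₗ
                    ((a : ℂ) • QkW L m n φ U hL αU hα1 hU1 hreg (c₀ := c₀) (c₁ := c₁)))
              ((H1LatticeCLM (L := (L : ℝ)) (η := η) (lev₀ := lev₀) (levB := levB) φ hposπ hQ lev₁ Dc₁ X)) -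
          currentCLM φ lev₁ Dc₂ (laplaceAk L m n φ η (fun _ : Bond d (towerP L m (n + 1)) => (1 : 𝔸ˣ)) hL (fun _ => 0) (fun _ => by norm_num)
                  (perCfg_UlevOf_one_mem_U1 L m (n + 1)) (norm_Wcx_UlevOf_one_sub_one_le L m (n + 1) (fun _ => 0) (fun _ => le_rfl)) τ (c₀ := c₀) (c₁ := c₁) a
                - LinearMap.adjoint (QkW L m n φ (fun _ : Bond d (towerP L m (n + 1)) => (1 : 𝔸ˣ)) hL (fun _ => 0) (fun _ => by norm_num)
              (perCfg_UlevOf_one_mem_U1 L m (n + 1)) (norm_Wcx_UlevOf_one_sub_one_le L m (n + 1) (fun _ => 0) (fun _ => le_rfl)) (c₀ := c₀) (c₁ := c₁)) ∘ₗ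
                    ((a : ℂ) • (QkW L m n φ (fun _ : Bond d (towerP L m (n + 1)) => (1 : 𝔸ˣ)) hL (fun _ => 0) (fun _ => by norm_num)
              (perCfg_UlevOf_one_mem_U1 L m (n + 1)) (norm_Wcx_UlevOf_one_sub_one_le L m (n + 1) (fun _ => 0) (fun _ => le_rfl)) (c₀ := c₀) (c₁ := c₁))))
              ((H1LatticeCLM (L := (L : ℝ)) (η := η) (lev₀ := lev₀) (levB := levB) (c := ((η : ℂ))⁻¹)
              (R := adTransportW φ (fun _ : Bond d (towerP L m (n + 1)) => (1 : 𝔸ˣ)))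
              (S := adTransportW φ fun _ : Bond d (towerP L m (n + 1)) => (1 : 𝔸ˣ)⁻¹) (Δ₁ := hessOp φ η (fun _ : Bond d (towerP L m (n + 1)) => (1 : 𝔸ˣ)) τ)
              (Rr := RofUk L m n φ η (fun _ : Bond d (towerP L m (n + 1)) => (1 : 𝔸ˣ)))
              (Q := (QkW L m n φ (fun _ : Bond d (towerP L m (n + 1)) => (1 : 𝔸ˣ)) hL (fun _ => 0) (fun _ => by norm_num)
                (perCfg_UlevOf_one_mem_U1 L m (n + 1)) (norm_Wcx_UlevOf_one_sub_one_le L m (n + 1) (fun _ => 0) (fun _ => le_rfl)) (c₀ := c₀) (c₁ := c₁))) (a := a)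
              φ hpos₁ hQ1 lev₁ Dc₂ X)) = Φ X := by
    rw [hΦ]; rfl
  have hpt : ∀ b' : Bond d (towerP L m (n + 1)), ‖NegSup.equiv (levWeight (L : ℝ) η lev₀ 3) 𝔸 (Φ X) b'‖ ≤
      (j₀ + α) * (Mφ * K * Mφ') * (d * latticeConst d κ) * ((NegSup.wInvSup (levWeight (L : ℝ) η levB 0) : ℝ) * ‖X‖) := by
    intro b'
    have hdec : NegSup.equiv (levWeight (L : ℝ) η lev₀ 3) 𝔸 (Φ X) b' =
        ∑ y : Bond d m, NegSup.equiv (levWeight (L : ℝ) η lev₀ 3) 𝔸 (Φ ((NegSup.equiv (levWeight (L : ℝ) η levB 0) 𝔸).symm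
          (Pi.single y (NegSup.equiv (levWeight (L : ℝ) η levB 0) 𝔸 X y)))) b' := by
      conv_lhs => rw [← negSup_sum_single X]
      rw [map_sum, ← NegSup.evalCLM_apply (𝕜 := ℂ), map_sum]
      simp only [NegSup.evalCLM_apply]
    rw [hdec]
    refine (norm_sum_le _ _).trans ?_
    calc _ ≤ ∑ y : Bond d m, (j₀ + α) * (Mφ * K * Mφ') * Real.exp (-(κ * tdist m (blockCoord (L ^ (n + 1)) m
              (siteCast (towerP_eq_fineP_pow L m (n + 1)) (bpos b'))) (bpos y))) * ((NegSup.wInvSup (levWeight (L : ℝ) η levB 0) : ℝ) * ‖X‖) :=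
          Finset.sum_le_sum fun y _ => by
            have h := HB n η hηL c₀ c₁ hw hρ m hm U αU hα0 hα1 hαL hU1 hreg εU hεU hε1 hUε hLb α hα hαle hUst hUb hUη hUw hpl hUgrad hRlev hεg hAQ hpos' hpos hc₀η
              j₀ hJ hj hposπ hQ hpos'₁ hpos₁ hQ1 lev₀ lev₁ Dc₁ Dc₂ levB y (NegSup.equiv (levWeight (L : ℝ) η levB 0) 𝔸 X y) b'
            rw [hΦ, sub_apply, ContinuousLinearMap.comp_apply, ContinuousLinearMap.comp_apply, NegSup.equiv_sub, Pi.sub_apply]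
            exact h.trans (mul_le_mul_of_nonneg_left (hX y) (by positivity))
      _ = (j₀ + α) * (Mφ * K * Mφ') * (∑ y : Bond d m, Real.exp (-(κ * tdist m (blockCoord (L ^ (n + 1)) m
              (siteCast (towerP_eq_fineP_pow L m (n + 1)) (bpos b'))) (bpos y)))) * ((NegSup.wInvSup (levWeight (L : ℝ) η levB 0) : ℝ) * ‖X‖) := by
          rw [Finset.mul_sum, Finset.sum_mul]
      _ ≤ _ := by gcongr; exact hrow b'
  have hsup : ‖NegSup.equiv (levWeight (L : ℝ) η lev₀ 3) 𝔸 (Φ X)‖ ≤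
      (j₀ + α) * (Mφ * K * Mφ') * (d * latticeConst d κ) * ((NegSup.wInvSup (levWeight (L : ℝ) η levB 0) : ℝ) * ‖X‖) :=
    (pi_norm_le_iff_of_nonneg (by positivity)).2 hpt
  rw [hΦX]
  refine (NegSup.norm_le_wSup_mul _).trans ?_
  calc (NegSup.wSup (levWeight (L : ℝ) η lev₀ 3) : ℝ) * ‖NegSup.equiv (levWeight (L : ℝ) η lev₀ 3) 𝔸 (Φ X)‖
      ≤ (NegSup.wSup (levWeight (L : ℝ) η lev₀ 3) : ℝ) * ((j₀ + α) * (Mφ * K * Mφ') * (d * latticeConst d κ) * ((NegSup.wInvSup (levWeight (L : ℝ) η levB 0) : ℝ) * ‖X‖)) :=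
        mul_le_mul_of_nonneg_left hsup (NNReal.coe_nonneg _)
    _ = _ := by ring

end Literature.MathematicalPhysics.QuantumFieldTheory.Balaban1983to89.B11Eq88LaplaceH1CurrentTwoBackgroundOneBlockColumn

end
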